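import Summits.AnomalousDissipation.AnomalousDissipation.Theorems.SolenoidalFractalHomogenisationCascadeBookkeepingComposition
import Summits.AnomalousDissipation.AnomalousDissipation.Theorems.SolenoidalFractalHomogenisationCascadeBookkeepingLowerEnergy
import Summits.AnomalousDissipation.AnomalousDissipation.Theorems.SolenoidalFractalHomogenisationCascadeBookkeepingExistence
import HarnessLib

/-!
# `SolenoidalFractalHomogenisation.CascadeBookkeeping` holds (route `route-AnomalousDissipation-SolenoidalFractalHomogenisation`,
# support item `CascadeBookkeeping`, stmt-AnomalousDissipation-19074)

The bookkeeping support item of the route — `∀ k (D : FractalCarrierData k), D.Permissible → D.Regular →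
D.RenormalisationBound → Target` — by the registered skeleton `energy-road` (seat ad-solenoidal-cb-p1, cell ad-ideate):
the composition `cascadeBookkeeping_of_exists_of_lowerEnergy`
(`Theorems/SolenoidalFractalHomogenisationCascadeBookkeepingComposition`, p528227: Hölder-carrier time bookkeeping over
`PermissibleFractalCarrierTime`, the decay fraction `η(R)` gone by `t = 1/2` at the renormalised viscosities and Poincaré
decay at the finitely many others, `c(R) = min(η'/2, 4π²m/(1+8π²m))`) applied to its two registered stubs, both landed
by name: `stub_existence` (V1, A0 weak existence by J.-L. Lions' theorem,
`Theorems/SolenoidalFractalHomogenisationCascadeBookkeepingExistence` over `Literature…PassiveVectorLionsExistence`) and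
`stub_lowerEnergy` (V2, the lower energy inequality from the energy equality,
`Theorems/SolenoidalFractalHomogenisationCascadeBookkeepingLowerEnergy`, p535182, over
`Literature…PassiveVectorEnergyEquality`). Honest framing: this is rung-leaf bookkeeping on F-D1 (route 1) only —
nothing about anomalous dissipation in general is claimed here.
-/

-- `Summit.<Summit>.<Problem>` is the tree's mandated summit-side namespace (CONVENTIONS §2); for this
-- single-conjunct summit the two coincide, so the duplicate is deliberate (lakefile: off for `Summits`).
set_option linter.dupNamespace false

namespace Summit.AnomalousDissipation.AnomalousDissipation.Theorems

/-- Closes the route support item `CascadeBookkeeping` (stmt-AnomalousDissipation-19074): the registered skeleton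
`energy-road` — composition `cascadeBookkeeping_of_exists_of_lowerEnergy` of the landed stubs `stub_existence` (V1) and
`stub_lowerEnergy` (V2). -/
theorem solenoidalFractalHomogenisation_cascadeBookkeeping_proof :
    Summit.AnomalousDissipation.AnomalousDissipation.Theses.SolenoidalFractalHomogenisation.CascadeBookkeeping :=
  SolenoidalFractalHomogenisation.CascadeBookkeeping.cascadeBookkeeping_of_exists_of_lowerEnergy
    SolenoidalFractalHomogenisation.CascadeBookkeeping.stub_existence
    SolenoidalFractalHomogenisation.CascadeBookkeeping.stub_lowerEnergy

end Summit.AnomalousDissipation.AnomalousDissipation.Theorems
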